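import Literature.IUT.HodgeTheaters.GlobalFrobenioidsGaloisChartNonVacuityWitness
import Literature.NumberTheory.NumberFields.InfinitelyDivisibleEqOne
import Literature.NumberTheory.NumberFields.AbsoluteGaloisGroupNotSolvable
import Literature.NumberTheory.NumberFields.SecondDerivedSubgroupFixesRadicals
import Literature.IUT.HodgeTheaters.GlobalFrobenioidsCoricRigidityFieldLevel
import Mathlib.FieldTheory.Galois.Infinite
import Mathlib.RingTheory.RootsOfUnity.AlgebraicallyClosed
import Mathlib.NumberTheory.Padics.PadicVal.Basic
import Mathlib.RingTheory.Localization.Integral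
import Mathlib.RingTheory.IntegralClosure.IntegrallyClosed
import HarnessLib

/-!
# [IUTchI] Example 5.1 (v), pp. 127–128, with Remark 3.1.7 (ii)/(iii): the Galois toy `ℚ̄ ↶ G_ℚ` inhabits the
# field-level law binders of the layer-5 certificate row `IUTchI:Ex5.1(v)` AND the E51/L23 binder `h_Ex51v_moves`
# (NV annex A2+; proof-only)

S. Mochizuki, *Inter-universal Teichmüller theory I*, kurims manuscript (May 2020), §5 Example 5.1 (v), p. 127
l. 30–35 («the `π₁^rat(†𝒟^⊛)`-action that appears in an ∞κ-coric (respectively, ∞κ×-coric) structure necessarily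
factors (respectively, does not factor) through the natural surjection `π₁^rat(†𝒟^⊛) ↠ π₁^{κ-sol}(†𝒟^⊛)` of (i)»,
verbatim from the cell render lit/IUTchI-EX51v-VERBATIM.md l.11; v2 doc-only: quotation completed, referee flag
M19-F9) and §3
Remark 3.1.7 (ii)/(iii) pp. 67–68 (its mechanism: `F^{sol} ≠ F̄`) ([IUTchI] Ex 5.1 (v) p.127)
[claim: Mochizuki2012, status: disputed] (D-0012 claim key; nothing disputed is asserted; no side is taken on
[IUTchIII] Cor. 3.12).

Cell abc-iut, layer-5 certificate rows: `layer5_held_ex51v_v5_fieldLevel` (`Conditional/Layer5OfSV05.lean`; binders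
`hroot` `hprim` `h1` `hpow` `h_Ex51v_div` `h_Ex51v_ordmul` `h_Ex51v_polex` `h_Ex51v_zero`) and the E51/L23 binder
`h_Ex51v_moves : ∃ g ∈ π₁^{rat/κ-sol}, ∃ f ∈ 𝕄^⊛_∞κ×, g • f ≠ f` of `layer5_held_ex51v(_v2)`.  The sibling NV annex
`GlobalFrobenioidsCoricFieldLevelNonVacuity.lean` (abc-iut-w4-d050, p441507) inhabits the field-level block at the
Galois toy; THIS file shows that THE SAME datum also inhabits `h_Ex51v_moves`, by PRINT'S OWN MECHANISM: the
second derived subgroup `G_ℚ''` fixes every radical of a power of `2` (= every ∞κ-coric function of the toy;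
classical, `Literature.NumberTheory.NumberFields.derivedSeries_two_apply_eq_self_of_pow_mem`), hence lies in
`π₁^{rat/κ-sol}`; and `G_ℚ'' ≠ 1` because `G_ℚ` is NOT SOLVABLE (abc-iut-L5-t14's `absoluteGaloisGroup_not_isSolvable`,
p438028 — «`G_{F_mod}` is not prosolvable»), so some `g ∈ G_ℚ''` moves an algebraic number, hence an algebraic integer
`β`, and algebraic integers are ∞κ×-coric in the toy (their rational powers are integers: `v₂ ≥ 0`).

* `NFBridgeRecon.CoricLawsToy.exists_fieldLevel_laws_moves` — ONE datum, 14 conjuncts: non-commutativity of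
  `π₁^rat`, the 9 binders of `layer5_held_ex51v_v5_fieldLevel`, the ∞κ× field-level variants, AND `h_Ex51v_moves`.
The datum is rebuilt verbatim from p441507 (it is proof-internal there): `K_rat := ℚ̄`, `π₁^rat := G_ℚ`
(`absGalGrp ℚ`, abc-iut-w4-d066's `fbarActionAlong` / `isOpen_stabilizer_along`), `𝕄^⊛_∞κ :=` radicals of powers of `2`,
`𝕄^⊛_∞κ× := {f ≠ 0 | rational powers have v₂ ≥ 0}`, `solKer := ⊤`, `X := Fin 2`, `ord := v₂` on `ℚ`.
HONEST LABEL: NV annex; DEGENERATE TOY on the function-field side with GENUINE Galois side; **inhabited ≠ discharged;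
no census change**; not a claim about the genuine `Gal(L̄_C/L_C)`-datum.  PROOF-ONLY: no `def`, no `instance`, no
`structure`, no new Prop fact; nothing of w4-d056 / w4-d066 / L5-t14 / L5-d1 / L5-d5 edited.  typed ≠ proved.
-/

namespace Literature.IUT.HodgeTheaters

namespace NFBridgeRecon

namespace CoricLawsToy

open Literature.AlgebraicGeometry.Frobenioids

/-- **The Galois toy inhabits the field-level block AND `h_Ex51v_moves`.**  One datum (`N`, `X := Fin 2`, `ord`)
with NON-commutative `π₁^rat(†𝒟^⊛)` at which hold: `hroot`, `hprim`, `h1`, `hpow`, `h1×`, `hpow×`, `h_Ex51v_div`,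
`h_Ex51v_ordmul`, `hpole`, `h_Ex51v_zero`, `h_Ex51v_polex`, `hex×` (as in p441507) AND
`h_Ex51v_moves : ∃ g ∈ π₁^{rat/κ-sol}, ∃ f ∈ 𝕄^⊛_∞κ×, g • f ≠ f` — the latter by print's mechanism («`G_{F_mod}` not
prosolvable»: `G_ℚ''` fixes the radicals but is non-trivial).  NV annex; inhabited ≠ discharged; no census change.
([IUTchI] Ex 5.1 (v) p.127) [claim: Mochizuki2012, status: disputed] -/
theorem exists_fieldLevel_laws_moves :
    ∃ (N : NFBridgeRecon.{0}) (X : Type) (ord : X → N.Krat → ℤ),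
      (∃ a b : N.piRat, a * b ≠ b * a) ∧
      (∀ a : N.Krat, a ≠ 0 → ∀ n : ℕ, 0 < n → ∃ b : N.Krat, b ^ n = a) ∧
      (∀ n : ℕ, 0 < n → ∃ ζ : N.Krat, IsPrimitiveRoot ζ n) ∧
      (1 : N.Krat) ∈ N.Minfκ ∧
      (∀ (f : N.Krat) (n : ℕ), 0 < n → (f ∈ N.Minfκ ↔ f ^ n ∈ N.Minfκ)) ∧
      (1 : N.Krat) ∈ N.Minfκx ∧
      (∀ (f : N.Krat) (n : ℕ), 0 < n → (f ∈ N.Minfκx ↔ f ^ n ∈ N.Minfκx)) ∧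
      (∀ (H : OpenNormalSubgroup N.piRat) (a : N.Krat), a ≠ 0 → (∀ h : N.piRat, h ∈ H → h • a = a) →
        (∀ n : ℕ+, ∃ b : N.Krat, (∀ h : N.piRat, h ∈ H → h • b = b) ∧ b ^ (n : ℕ) = a) → a = 1) ∧
      (∀ (x : X) (a b : N.Krat), a ≠ 0 → b ≠ 0 → (∀ g : N.piRat, g • a = a) → (∀ g : N.piRat, g • b = b) →
        ord x (a * b) = ord x a + ord x b) ∧
      (∀ f' ∈ N.Minfκ, (∀ g : N.piRat, g • f' = f') →
        ∀ x₁ x₂ : X, x₁ ≠ x₂ → ¬ (ord x₁ f' < 0 ∧ ord x₂ f' < 0)) ∧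
      (∃ f ∈ N.Minfκ, (∀ g : N.piRat, g • f = f) ∧ ∃ x₁ x₂ : X, x₁ ≠ x₂ ∧ 0 < ord x₁ f ∧ 0 < ord x₂ f) ∧
      (∀ f' ∈ N.Minfκx, (∀ g : N.piRat, g • f' = f') →
        ∀ x₁ x₂ : X, x₁ ≠ x₂ → ¬ (ord x₁ f' < 0 ∧ ord x₂ f' < 0)) ∧
      (∃ f ∈ N.Minfκx, (∀ g : N.piRat, g • f = f) ∧ ∃ x₁ x₂ : X, x₁ ≠ x₂ ∧ 0 < ord x₁ f ∧ 0 < ord x₂ f) ∧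
      (∃ g ∈ N.ratKsolKer, ∃ f ∈ N.Minfκx, g • f ≠ f) := by
  classical
  let K : Type := QuasiTemperoid.Fbar ℚ
  let G : ProfiniteGrp.{0} := absGalGrp ℚ
  let ρ : G →ₜ* QuasiTemperoid.GalFbar ℚ := ContinuousMonoidHom.id G
  letI act : MulSemiringAction G K := fbarActionAlong ℚ ρ
  haveI : IsGalois ℚ K := isGalois_fbar ℚ
  haveI : Fact (Nat.Prime 2) := ⟨Nat.prime_two⟩
  have hsmul : ∀ (g : G) (f : K), g • f = (g : QuasiTemperoid.GalFbar ℚ) f := fun _ _ => rfl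
  have hinj : Function.Injective (algebraMap ℚ K) := (algebraMap ℚ K).injective
  -- fixed elements are rational (Krull)
  have hfixed : ∀ f : K, (∀ g : G, g • f = f) → ∃ q : ℚ, f = algebraMap ℚ K q := by
    intro f hf
    obtain ⟨q, hq⟩ := IntermediateField.mem_bot.1 ((InfiniteGalois.mem_bot_iff_fixed f).2 fun g => hf g)
    exact ⟨q, hq.symm⟩
  have hfix_alg : ∀ (q : ℚ) (g : G), g • algebraMap ℚ K q = algebraMap ℚ K q :=
    fun q g => (g : QuasiTemperoid.GalFbar ℚ).commutes q
  /- the two coric sets -/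
  let T : Set K := {f | ∃ m : ℕ, 0 < m ∧ ∃ a : ℕ, f ^ m = (2 : K) ^ a}
  let S : Set K := {f | f ≠ 0 ∧ ∀ m : ℕ, 0 < m → ∀ q : ℚ, f ^ m = algebraMap ℚ K q → 0 ≤ padicValRat 2 q}
  have h2K : (2 : K) ≠ 0 := two_ne_zero
  have hv2 : padicValRat 2 (2 : ℚ) = 1 := by
    rw [show (2 : ℚ) = ((2 : ℕ) : ℚ) by norm_num, padicValRat.self one_lt_two]
  have hT1 : (1 : K) ∈ T := ⟨1, one_pos, 0, by rw [one_pow, pow_zero]⟩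
  have hT0 : (0 : K) ∉ T := by
    rintro ⟨m, hm, a, h⟩
    rw [zero_pow hm.ne'] at h
    exact pow_ne_zero a h2K h.symm
  have hTpow : ∀ (f : K) (n : ℕ), 0 < n → (f ∈ T ↔ f ^ n ∈ T) := by
    intro f n hn
    constructor
    · rintro ⟨m, hm, a, h⟩
      exact ⟨m, hm, a * n, by rw [← pow_mul, mul_comm n m, pow_mul, h, ← pow_mul]⟩
    · rintro ⟨m, hm, a, h⟩
      exact ⟨n * m, Nat.mul_pos hn hm, a, by rw [pow_mul, h]⟩
  have hTsmul : ∀ (g : G) {f : K}, f ∈ T → g • f ∈ T := by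
    rintro g f ⟨m, hm, a, h⟩
    refine ⟨m, hm, a, ?_⟩
    rw [hsmul, ← map_pow, h, map_pow, map_ofNat]
  -- the 2-adic valuation of a rational power of an element of `T` is nonnegative
  have hTval : ∀ (f : K), f ∈ T → ∀ m : ℕ, 0 < m → ∀ q : ℚ, f ^ m = algebraMap ℚ K q → 0 ≤ padicValRat 2 q := by
    rintro f ⟨m₀, hm₀, a, h⟩ m hm q hq
    -- `q ^ m₀ = 2 ^ (a m)` in `ℚ`
    have hq' : algebraMap ℚ K (q ^ m₀) = algebraMap ℚ K ((2 : ℚ) ^ (a * m)) := by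
      rw [map_pow, ← hq, ← pow_mul, mul_comm m m₀, pow_mul, h, ← pow_mul, map_pow, map_ofNat]
    have hqq : q ^ m₀ = (2 : ℚ) ^ (a * m) := hinj hq'
    have hq0 : q ≠ 0 := by
      rintro rfl
      rw [zero_pow hm₀.ne'] at hqq
      exact pow_ne_zero _ two_ne_zero hqq.symm
    have hv : (m₀ : ℤ) * padicValRat 2 q = (a * m : ℕ) * padicValRat 2 2 := by
      rw [← padicValRat.pow, ← padicValRat.pow, hqq]
    rw [hv2, mul_one] at hv
    have hm₀' : (0 : ℤ) < m₀ := by exact_mod_cast hm₀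
    nlinarith [hv, Int.natCast_nonneg (a * m)]
  have hTS : T ⊆ S := fun f hf => ⟨fun h0 => hT0 (h0 ▸ hf), hTval f hf⟩
  have hS1 : (1 : K) ∈ S := hTS hT1
  have hS0 : (0 : K) ∉ S := fun h => h.1 rfl
  have hSpow : ∀ (f : K) (n : ℕ), 0 < n → (f ∈ S ↔ f ^ n ∈ S) := by
    intro f n hn
    constructor
    · rintro ⟨hf0, hf⟩
      exact ⟨pow_ne_zero _ hf0, fun m hm q h => hf (n * m) (Nat.mul_pos hn hm) q (by rw [pow_mul, h])⟩
    · rintro ⟨hf0, hf⟩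
      refine ⟨fun h0 => hf0 (by rw [h0, zero_pow hn.ne']), fun m hm q h => ?_⟩
      have hq0 : q ≠ 0 := by
        rintro rfl
        rw [map_zero] at h
        exact hf0 (by rw [(pow_eq_zero_iff hm.ne').1 h, zero_pow hn.ne'])
      have h' := hf m hm (q ^ n) (by rw [map_pow, ← h, ← pow_mul, ← pow_mul, mul_comm])
      rw [padicValRat.pow] at h'
      have hn' : (0 : ℤ) < n := by exact_mod_cast hn
      nlinarith [h']
  have hSsmul : ∀ (g : G) {f : K}, f ∈ S → g • f ∈ S := by
    rintro g f ⟨hf0, hf⟩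
    refine ⟨?_, fun m hm q h => hf m hm q ?_⟩
    · rw [hsmul]
      exact (map_ne_zero_iff _ (g : QuasiTemperoid.GalFbar ℚ).injective).2 hf0
    · rw [hsmul, ← map_pow] at h
      have h' := congrArg (g : QuasiTemperoid.GalFbar ℚ).symm h
      have h'' : (g : QuasiTemperoid.GalFbar ℚ).symm (algebraMap ℚ K q) = algebraMap ℚ K q :=
        (g : QuasiTemperoid.GalFbar ℚ).symm.commutes q
      rw [AlgEquiv.symm_apply_apply, h''] at h'
      exact h'
  /- the interface datum -/
  let N : NFBridgeRecon.{0} :=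
    { l := 5
      piDast := G
      piDcirc := ⊤
      Fbar := K
      fbarField := inferInstance
      fbarAction := act
      isOpen_stabilizer_fbar := isOpen_stabilizer_along ℚ ρ
      piRat := G
      ratToAst := ContinuousMonoidHom.id G
      ratToAst_surjective := Function.surjective_id
      Krat := K
      kratField := inferInstance
      kratAction := act
      isOpen_stabilizer_krat := isOpen_stabilizer_along ℚ ρ
      const := RingHom.id K
      const_smul := fun _ _ => rfl
      Mκ := T
      Minfκ := T
      Minfκx := S
      mκ_subset := subset_rfl
      minfκ_subset := hTS
      zero_notMem := hS0
      smul_mem_minfκ := fun g _ hf => hTsmul g hf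
      smul_mem_minfκx := fun g _ hf => hSsmul g hf
      solKer := ⊤
      solKer_normal := inferInstance
      AutD := PUnit
      autGroup := inferInstance
      Autε := ⊤
      AutSL := ⊤
      AutSLε := ⊤
      autSLε_le := le_rfl
      autSLε_le_autε := le_rfl
      lift := fun _ => ContinuousMulEquiv.refl G }
  /- the order map: the 2-adic valuation on `ℚ`, `0` elsewhere, at both points of `X := Fin 2` -/
  let ordK : K → ℤ := fun f => if h : ∃ q : ℚ, f = algebraMap ℚ K q then padicValRat 2 h.choose else 0
  have ord_alg : ∀ q : ℚ, ordK (algebraMap ℚ K q) = padicValRat 2 q := by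
    intro q
    have hh : ∃ q' : ℚ, algebraMap ℚ K q = algebraMap ℚ K q' := ⟨q, rfl⟩
    have h1 : ordK (algebraMap ℚ K q) = padicValRat 2 hh.choose := dif_pos hh
    rw [h1, ← hinj hh.choose_spec]
  -- pole shape on the fixed elements of `S`: a fixed element is rational with `v₂ ≥ 0`
  have hpoleS : ∀ f' ∈ S, (∀ g : G, g • f' = f') → ∀ x₁ x₂ : Fin 2, x₁ ≠ x₂ → ¬ (ordK f' < 0 ∧ ordK f' < 0) := by
    intro f' hf' hfix x₁ x₂ _ h
    obtain ⟨q, rfl⟩ := hfixed f' hfix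
    have hv := hf'.2 1 one_pos q (pow_one _)
    rw [ord_alg] at h
    exact (not_lt.2 hv) h.1
  have h01 : (0 : Fin 2) ≠ 1 := by decide
  have h2T : (algebraMap ℚ K 2) ∈ T := ⟨1, one_pos, 1, by rw [pow_one, pow_one, map_ofNat]⟩
  have hex2 : 0 < ordK (algebraMap ℚ K 2) := by rw [ord_alg, hv2]; exact one_pos
  /- E51/L23 `moves`: an element of the second derived subgroup `G_ℚ''` fixes the radicals (E3a) — hence lies in
     `π₁^{rat/κ-sol} = actionKer ⊓ comap ⊤` — and, `G_ℚ` being NOT solvable (abc-iut-L5-t14), some such element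
     moves an algebraic number, hence an algebraic INTEGER, which lies in `𝕄^⊛_∞κ×`. -/
  have hmoves : ∃ g ∈ N.ratKsolKer, ∃ f ∈ N.Minfκx, g • f ≠ f := by
    -- `G'' ≠ ⊥`
    have hD2 : derivedSeries (QuasiTemperoid.GalFbar ℚ) 2 ≠ ⊥ := by
      intro hbot
      exact Literature.NumberTheory.NumberFields.absoluteGaloisGroup_not_isSolvable ℚ ⟨⟨2, hbot⟩⟩
    obtain ⟨g, hgD, hg1⟩ : ∃ g ∈ derivedSeries (QuasiTemperoid.GalFbar ℚ) 2, g ≠ 1 := by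
      by_contra hall
      apply hD2
      rw [eq_bot_iff]
      intro g hg
      rw [Subgroup.mem_bot]
      by_contra hne
      exact hall ⟨g, hg, hne⟩
    -- `g` moves some `γ`
    obtain ⟨γ, hγ⟩ : ∃ γ : K, (g : QuasiTemperoid.GalFbar ℚ) γ ≠ γ := by
      by_contra hall
      apply hg1
      ext x
      by_contra hx
      exact hall ⟨x, hx⟩
    -- an integral multiple `β = d • γ`
    have hγint : IsIntegral ℚ γ := (Algebra.IsAlgebraic.isAlgebraic (R := ℚ) γ).isIntegral
    obtain ⟨d, hdβ⟩ := IsIntegral.exists_multiple_integral_of_isLocalization (nonZeroDivisors ℤ) (Rₘ := ℚ) γ hγint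
    have hd0 : ((d : ℤ) : K) ≠ 0 := by
      have hdz : (d : ℤ) ≠ 0 := nonZeroDivisors.coe_ne_zero d
      exact_mod_cast hdz
    have hβint : IsIntegral ℤ (((d : ℤ) : K) * γ) := by
      have hβ : ((d : ℤ) : K) * γ = d • γ := by rw [Submonoid.smul_def, zsmul_eq_mul]
      rw [hβ]
      exact hdβ
    set β : K := ((d : ℤ) : K) * γ with hβdef
    have hγ0 : γ ≠ 0 := by
      rintro rfl
      exact hγ (map_zero _)
    have hβ0 : β ≠ 0 := mul_ne_zero hd0 hγ0
    -- `g` moves `β`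
    have hgβ : (g : QuasiTemperoid.GalFbar ℚ) β ≠ β := by
      intro h
      rw [hβdef, map_mul, map_intCast] at h
      exact hγ (mul_left_cancel₀ hd0 h)
    -- `β ∈ S`: a rational power of an algebraic integer is an integer
    have hβS : β ∈ S := by
      refine ⟨hβ0, fun m hm q h => ?_⟩
      have hqint : IsIntegral ℤ (algebraMap ℚ K q) := h ▸ hβint.pow m
      rw [isIntegral_algebraMap_iff hinj] at hqint
      obtain ⟨z, hz⟩ := (IsIntegrallyClosed.isIntegral_iff (R := ℤ) (K := ℚ)).1 hqint
      rw [← hz, show (algebraMap ℤ ℚ z) = (z : ℚ) from rfl, padicValRat.of_int]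
      exact Int.natCast_nonneg _
    -- `g ∈ π₁^{rat/κ-sol}`: it fixes every radical of a power of `2`
    refine ⟨g, Subgroup.mem_inf.2 ⟨?_, Subgroup.mem_comap.2 (Subgroup.mem_top _)⟩, β, hβS, hgβ⟩
    rintro f ⟨m, hm, a, hf⟩
    change (g : QuasiTemperoid.GalFbar ℚ) f = f
    refine Literature.NumberTheory.NumberFields.derivedSeries_two_apply_eq_self_of_pow_mem hgD hm ⟨(2 : ℚ) ^ a, ?_⟩
    rw [map_pow, map_ofNat, hf]
  refine ⟨N, Fin 2, fun _ => ordK, ?_, ?_, ?_, hT1, hTpow, hS1, hSpow, ?_, ?_,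
    fun f' hf' hfix => hpoleS f' (hTS hf') hfix, ⟨algebraMap ℚ K 2, h2T, hfix_alg 2, 0, 1, h01, hex2, hex2⟩, hpoleS,
    ⟨algebraMap ℚ K 2, hTS h2T, hfix_alg 2, 0, 1, h01, hex2, hex2⟩, hmoves⟩
  · -- `G_ℚ` is not commutative (it is not even solvable: abc-iut-L5-t14)
    by_contra hall
    exact Literature.NumberTheory.NumberFields.absoluteGaloisGroup_not_isSolvable ℚ
      (isSolvable_of_comm fun a b => by by_contra hab; exact hall ⟨a, b, hab⟩)
  · -- `hroot`: `ℚ̄` is algebraically closed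
    exact fun a _ n hn => IsAlgClosed.exists_pow_nat_eq a hn
  · -- `hprim`: all roots of unity
    intro n hn
    haveI : NeZero (n : ℚ) := ⟨by exact_mod_cast hn.ne'⟩
    exact HasEnoughRootsOfUnity.exists_primitiveRoot K n
  · -- `h_Ex51v_div`: the fixed field of an open subgroup is a number field; there infinitely divisible ⇒ `1`
    intro H a ha hfa hroots
    let Hs : Subgroup (QuasiTemperoid.GalFbar ℚ) := H.toSubgroup
    let E : IntermediateField ℚ K := IntermediateField.fixedField Hs
    have hmemE : ∀ y : K, (∀ h : G, h ∈ H → h • y = y) → y ∈ E := by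
      intro y hy
      rw [IntermediateField.mem_fixedField_iff]
      intro f hf
      exact hy f hf
    -- `E` is finite over `ℚ` because `H` is open
    let Hc : ClosedSubgroup (QuasiTemperoid.GalFbar ℚ) := ⟨Hs, H.toOpenSubgroup.isClosed⟩
    have hfix : E.fixingSubgroup = Hs := InfiniteGalois.fixingSubgroup_fixedField Hc
    haveI : FiniteDimensional ℚ E := by
      refine (InfiniteGalois.isOpen_iff_finite E).1 ?_
      rw [hfix]
      exact H.toOpenSubgroup.isOpen'
    haveI : NumberField E := NumberField.mk
    -- transfer to `E`
    have ha' : (⟨a, hmemE a hfa⟩ : E) ≠ 0 := fun h0 => ha (congrArg Subtype.val h0)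
    have hroots' : ∀ n : ℕ, 0 < n → ∃ b : E, b ^ n = ⟨a, hmemE a hfa⟩ := by
      intro n hn
      obtain ⟨b, hb, hbn⟩ := hroots ⟨n, hn⟩
      exact ⟨⟨b, hmemE b hb⟩, Subtype.ext (by rw [IntermediateField.coe_pow]; exact hbn)⟩
    have := Literature.NumberTheory.NumberFields.eq_one_of_forall_exists_pow_eq ha' hroots'
    exact congrArg Subtype.val this
  · -- `h_Ex51v_ordmul`: fixed non-zero elements are rational and `v₂` is additive
    intro _ a b ha hb hfa hfb
    obtain ⟨qa, rfl⟩ := hfixed a hfa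
    obtain ⟨qb, rfl⟩ := hfixed b hfb
    have hqa : qa ≠ 0 := fun h => ha (by rw [h, map_zero])
    have hqb : qb ≠ 0 := fun h => hb (by rw [h, map_zero])
    change ordK (algebraMap ℚ K qa * algebraMap ℚ K qb) = ordK (algebraMap ℚ K qa) + ordK (algebraMap ℚ K qb)
    rw [← map_mul, ord_alg, ord_alg, ord_alg, padicValRat.mul hqa hqb]

end CoricLawsToy

end NFBridgeRecon

end Literature.IUT.HodgeTheaters
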